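import Summits.SmoothPoincare4.SmoothPoincare4.Theorems.SymplecticOrigamiNoGenusTwoDoorStubLiouvillePackaging
import Literature.Geometry.Symplectic.McleanDivisorComplementConvexFourProofs
import Literature.Geometry.Symplectic.CodimTwoComplementConnected
import Literature.Geometry.Symplectic.SublevelPreconnectedOfRegular
import HarnessLib

/-! # Stub `stub_liouvillePackaging` (S3) of line `canonical-cap-filling` for crux `NoGenusTwoDoor`
(stmt-SmoothPoincare4-7842, route SymplecticOrigami) — UNCONDITIONAL

**Statement (S3, Liouville packaging; the registered stub signature, verbatim).** Let `(N, s)` be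
a closed connected symplectic `4`-manifold (`s : MForm`, chartwise smooth, closed, pointwise
non-degenerate), `B = b(S)` a smoothly embedded compact connected `s`-symplectic surface,
`U = N ∖ B`, and suppose `s|_U = dθ` is exact.  Then for every open `V ⊇ B` there are a compact
connected Liouville domain `(W, λ)` in the tree's sense
(`Literature.Geometry.Symplectic.IsLiouvilleDomain`) and an injective immersion `ι : W → N` with
`N ∖ V ⊆ ι(W) ⊆ N ∖ B` and `dλ = ι^* s`.

**What is proved here.** The stub itself, with no hypothesis left.  The sibling file
`SymplecticOrigamiNoGenusTwoDoorStubLiouvillePackaging.lean` (p92246, 2026-08-16) proved the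
registered signature from three named facts of the tree
(`stub_liouvillePackaging_of_mclean`); all three have since been DISCHARGED in `Literature/`:

* `Literature.Geometry.Symplectic.mclean_divisorComplement_convex_four_holds`
  (`McleanDivisorComplementConvexFourProofs.lean`, 2026-08-16T21:17Z; McLean 2012, Lemma 5.17 with
  Lemma 5.14: the exact complement of a closed symplectic surface carries a primitive `λ` of `s`
  and an exhausting function `g` with `dg(X_λ) > 0` near infinity);
* `Literature.Geometry.Symplectic.isConnected_compl_range_of_isSmoothEmbedding_holds`
  (`CodimTwoComplementConnected.lean`; Kosinski 1993, X.1: complements of compact codimension-`≥ 2`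
  submanifolds of connected manifolds are connected and nonempty);
* `Literature.Geometry.Symplectic.isPreconnected_sublevel_of_forall_mfderiv_ne_zero_holds`
  (`SublevelPreconnectedOfRegular.lean`; Milnor 1963, Thm. 3.1: high sublevel sets of an
  exhausting function without high critical points are connected).

So S3 is a theorem of the tree: `stub_liouvillePackaging` below is
`stub_liouvillePackaging_of_mclean` applied to the three `_holds` theorems.  After this file the
registered skeleton `Cruxes/NoGenusTwoDoor/Lines/canonical_cap_filling.lean` has exactly two
`sorry`s left: S1 `stub_taubesCanonicalCurve` (closed modulo Taubes's `SW ⇒ Gr` named fact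
`taubes_canonicalClass_symplecticCurve_four`, p87978) and S4 `stub_flatFillingExclusion`
(⟺ the crux, `flatFillingExclusion_iff`, p94693).

Sources: McLean, GAFA 22 (2012) = arXiv:1011.2542, Lemmas 5.14, 5.17; Diogo–Lisi, J. Topol. 12
(2019), §2.1, Lemma 2.2; McDuff–Salamon (2017), Thm. 3.4.10; Milnor, *Morse theory* (1963),
Thm. 3.1; Kosinski (1993), X.1; Cieliebak–Eliashberg (2012), §11.1.
-/

noncomputable section
set_option linter.dupNamespace false
open scoped _root_.Manifold _root_.ContDiff _root_.Topology _root_.ContinuousMap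
open _root_.Set _root_.Function _root_.TopologicalSpace
open Literature.Geometry.Kaehler (MForm IsSmoothForm IsClosedForm mextDeriv)

namespace Summit.SmoothPoincare4.SmoothPoincare4.Theorems.NoGenusTwoDoor.CanonicalCapFilling

/-- **S3, Liouville packaging of the exact complement of a symplectic surface (unconditional).**
For a closed connected symplectic `4`-manifold `(N, s)` in the tree's `MForm` vocabulary, a
smoothly embedded compact connected `s`-symplectic surface `B = b(S)` with `s` exact on
`U = N ∖ B`, and every open `V ⊇ B`, there is a compact connected Liouville domain `(W, λ)`
(`IsLiouvilleDomain`) with an injective immersion `ι : W → N`, `N ∖ V ⊆ ι(W) ⊆ N ∖ B`,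
`dλ = ι^* s`.  This is the registered stub `stub_liouvillePackaging` of the line
`canonical-cap-filling`, obtained from the conditional tree theorem
`stub_liouvillePackaging_of_mclean` (p92246) by feeding it the three discharged named facts
`mclean_divisorComplement_convex_four_holds` (McLean 2012, Lemma 5.17),
`isConnected_compl_range_of_isSmoothEmbedding_holds` (Kosinski X.1) and
`isPreconnected_sublevel_of_forall_mfderiv_ne_zero_holds` (Milnor Thm. 3.1).
[cite: Mclean2012, Lemma 5.17 with Lemma 5.14] -/
theorem stub_liouvillePackaging :
    ∀ (N : Type) [TopologicalSpace N] [T2Space N] [SecondCountableTopology N] [CompactSpace N]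
      [ConnectedSpace N] [ChartedSpace (EuclideanSpace ℝ (Fin 4)) N] [IsManifold (𝓡 4) ∞ N]
      (s : MForm (𝓡 4) N ℝ 2)
      (S : Type) [TopologicalSpace S] [T2Space S] [CompactSpace S] [ConnectedSpace S]
      [ChartedSpace (EuclideanSpace ℝ (Fin 2)) S] [IsManifold (𝓡 2) ∞ S] (b : S → N)
      (U : Opens N),
      IsSmoothForm s → IsClosedForm s →
      (∀ x (v : TangentSpace (𝓡 4) x), v ≠ 0 → ∃ w, s x ![v, w] ≠ 0) →
      Manifold.IsSmoothEmbedding (𝓡 2) (𝓡 4) ∞ b →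
      (∀ y (v : TangentSpace (𝓡 2) y), v ≠ 0 → ∃ w : TangentSpace (𝓡 2) y,
        s (b y) ![mfderiv (𝓡 2) (𝓡 4) b y v, mfderiv (𝓡 2) (𝓡 4) b y w] ≠ 0) →
      (U : Set N) = (Set.range b)ᶜ →
      (∃ θ : MForm (𝓡 4) U ℝ 1, IsSmoothForm θ ∧
        mextDeriv θ = s.pullback (𝓡 4) (Subtype.val : U → N)) →
      ∀ V : Set N, IsOpen V → Set.range b ⊆ V →
        ∃ (W : Type) (_ : TopologicalSpace W) (_ : T2Space W) (_ : SecondCountableTopology W)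
          (_ : CompactSpace W) (_ : ConnectedSpace W) (_ : ChartedSpace (EuclideanHalfSpace 4) W)
          (_ : IsManifold (𝓡∂ 4) ∞ W) (lam : MForm (𝓡∂ 4) W ℝ 1) (ι : W → N),
          Literature.Geometry.Symplectic.IsLiouvilleDomain W lam ∧
          ContMDiff (𝓡∂ 4) (𝓡 4) ∞ ι ∧ Function.Injective ι ∧
          (∀ x, Function.Injective (mfderiv (𝓡∂ 4) (𝓡 4) ι x)) ∧
          Set.range ι ⊆ (Set.range b)ᶜ ∧ Vᶜ ⊆ Set.range ι ∧
          mextDeriv lam = s.pullback (𝓡∂ 4) ι :=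
  stub_liouvillePackaging_of_mclean
    Literature.Geometry.Symplectic.mclean_divisorComplement_convex_four_holds
    Literature.Geometry.Symplectic.isConnected_compl_range_of_isSmoothEmbedding_holds
    Literature.Geometry.Symplectic.isPreconnected_sublevel_of_forall_mfderiv_ne_zero_holds

end Summit.SmoothPoincare4.SmoothPoincare4.Theorems.NoGenusTwoDoor.CanonicalCapFilling

end
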